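import Literature.Probability.Percolation.OneArmAnnulusCrossingCoherence
import Literature.Probability.Percolation.OneArmFromTrace
import Literature.Analysis.Complex.KoebeQuarterProofs
import HarnessLib

/-!
# LSW's (3.1) with Theorem 1.2 from the subsequential trace identification alone (proofs only)

Topic `Literature/Probability/Percolation`; family `crit-perc`. Def-free, fact-free sequel of
`OneArmAnnulusCrossingCoherence.lean` and `OneArmFromTrace.lean`, about the named fact
`Literature.Probability.Percolation.LawlerSchrammWerner2002_annulusCrossing` (`OneArmLSW.lean`;
Lawler–Schramm–Werner, *One-arm exponent for critical 2D percolation*, Electron. J. Probab. **7**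
(2002), paper no. 2, **Theorem 1.2** (p. 2) with **(3.1)** (p. 8)): there is ONE function `u`
with `log u(r) / log r → 5/48` (`r ↓ 0`) and, for every `r ∈ (0, 1/2)` and all `R ≥ s₀(r)`,
`u(r/2)/2 ≤ P[C(rR, R)] ≤ 2 u(2r)`. Write `p(r, R) = P[C(rR, R)]`
(`(triSitePercolation half).real (triOpenCrossing (r * R) R)`).

State before this file. `OneArmAnnulusCrossingCoherence.lean` proved the fact from the uniform
power bounds `C⁻¹ r^{5/48}/2 ≤ p(r, R) ≤ 2 C r^{5/48}` (which LSW §2 delivers at subsequential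
scaling limits, `crossingBounds_of_subseqLimits`) together with *strict scale coherence*
`limsup_R p(r, R) < 4 liminf_R p(4r, R)` (`r ∈ (0, 1/8)`), and obtained coherence only from some
CONVERGENCE input (radial convergence of `p(r, ·)`, or weak convergence of the hull laws
`lswLaw (R_k)` along one sequence of scales with ratios `< 2` — formally weaker forms of the
uniqueness of the scaling limit `∃ ν, Tendsto lswLaw atTop (𝓝 ν)`, Smirnov 2001 /
Camia–Newman 2006 as LSW use them on p. 3; formerly the named fact
`LawlerSchrammWerner2002_scalingLimit`, since merged back into an explicit hypothesis).
Meanwhile `OneArmFromTrace.lean` reduced the other two continuum facts of the cone,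
`LawlerSchrammWerner2002_hittingPDE` and LSW Thm. 1.2
`LawlerSchrammWerner2002_scalingLimitExponent`, as well as the one-arm exponent itself, to the
*subsequential trace identification* alone: for every weak limit `ν` of `lswLaw` along a sequence
`R_k → ∞` and every `t > 0`, `u(2π, t) = ν{K | 𝔯(K) ≤ e^{-t}}` (`u = lswHit 6` the PROVED
semigroup solution of LSW's PDE (2.4), `𝔯` the conformal radius about `0`).

This file closes the gap: **coherence, hence the fact, follows from the subsequential trace
identification with no convergence input at all.** The point is LSW's (2.1),
`𝔯/4 ≤ dist(0, Q) ≤ 𝔯` (Koebe's one-quarter theorem — PROVED in this library,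
`Literature.Analysis.Complex.koebeQuarter_holds` — and the Schwarz lemma), read at subsequential
limits: `{dist(0, K) ≤ ρ} ⊆ {𝔯(K) ≤ 4ρ}` and `{𝔯(K) < 4ρ} ⊆ {dist(0, K) < 4ρ}` (`4ρ ≤ 1`).
If ONE function `t ↦ h(2π, t)` gives `ν{𝔯 ≤ e^{-t}}` for every subsequential limit `ν`, then
by portmanteau along extracted subsequences (`eventually_crossing_le_of_subseqLimits`,
`eventually_le_crossing_of_subseqLimits`, tightness being free)

* `limsup_R p(ρ, R) ≤ h(2π, -log 4ρ)` (`limsup_crossing_le_hit_of_subseqId`), and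
* `h(2π, t) ≤ liminf_R p(4ρ, R)` for every `t > -log 4ρ` (`hit_le_liminf_crossing_of_subseqId`),
  hence `h(2π, -log 4ρ) ≤ liminf_R p(4ρ, R)` as soon as `h(2π, ·)` is right-continuous there
  (`hit_le_liminf_crossing_of_subseqId_of_continuousWithinAt`; left-continuity is automatic, a jump
  would be a common atom of the laws of `𝔯`);

so the two envelopes that (3.1) has to separate MEET at the continuum quantity
`h(2π, -log 4ρ) = P[𝔯 ≤ 4ρ] > 0`: Koebe's exact constant `1/4` is precisely the slack `2 · 2`
of the radii in (3.1). Strict coherence follows (`coherence_of_subseqId`), and with the uniform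
power bounds of `IsHittingPDEData.measure_bounds`:

* `LawlerSchrammWerner2002_annulusCrossing_of_subseqHittingPDE_of_continuousOn` — the fact from
  the subsequential hitting-PDE hypotheses `H : IsHittingPDEData h …`, `hid` (as in
  `oneArm_exponent_of_subseqHittingPDE`) plus continuity of `h(2π, ·)` on `(0, ∞)`; compare
  `LawlerSchrammWerner2002_annulusCrossing_of_subseqHittingPDE` (`OneArmAnnulusCrossingProofs.lean`),
  which needs radial convergence off a countable set instead;
* `LawlerSchrammWerner2002_annulusCrossing_of_subseqTrace` — **the fact from the subsequential
  trace identification ALONE** (`h = lswHit 6`, continuous in `t > 0` at `θ = 2π` by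
  `continuousOn_lswSeries_init_t`), the exact analogue of `oneArm_exponent_of_subseqTrace`,
  `LawlerSchrammWerner2002_hittingPDE_of_subseqTrace` and
  `LawlerSchrammWerner2002_scalingLimitExponent_of_subseqTrace` (`OneArmFromTrace.lean`); the
  sequel `OneArmAnnulusCrossingFromCoupling.lean` feeds it the trace identifications obtained from
  LSW's own hypothesis sets of §2 (renewal flatness, renewal domination, arc couplings);
* `crossing_mem_Icc_hit_of_subseqId`, `tendsto_log_hit_div_log`,
  `LawlerSchrammWerner2002_annulusCrossing_of_subseqHittingPDE_of_continuousOn'`,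
  `crossing_mem_Icc_lswHit_of_subseqTrace`, `tendsto_log_lswHit_div_log` — (3.1) with LSW's `u`
  made EXPLICIT, `u(r) = h(2π, -log 2r) = P[𝔯 ≤ 2r]`: for `r ∈ (0, 1/2)` and all large `R`,
  `h(2π, -log r)/2 ≤ P[C(rR, R)] ≤ 2 h(2π, -log 4r)`, and `log u(r)/log r → 5/48` from the
  exponential bounds of (2.17) (`IsHittingPDEData.exp_bounds`); for the trace, `h = lswHit 6` is
  the computable series solution.

After this file all three LSW continuum facts of the one-arm cone
(`LawlerSchrammWerner2002_annulusCrossing`, `…_hittingPDE`, `…_scalingLimitExponent`) and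
`oneArm_exponent` rest on exactly one hypothesis, the subsequential trace identification — LSW's
Theorem 2.1 (Smirnov: the `SLE₆` description of the scaling limit `Q(θ)`), the radial Loewner
equation (2.5)–(2.9) and the strong Markov property (2.10), i.e. the convergence of the
percolation exploration process to `SLE₆`, which neither Mathlib nor this library has. The
existence/uniqueness of the full scaling limit (`∃ ν, Tendsto lswLaw atTop (𝓝 ν)`) is not
needed for `LawlerSchrammWerner2002_annulusCrossing`.

What is NOT here: no discharge; no definitions; no named facts.

## References

* G. F. Lawler, O. Schramm, W. Werner, *One-arm exponent for critical 2D percolation*, Electron.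
  J. Probab. 7 (2002), no. 2 — Thm. 1.2 (p. 2), (2.1)–(2.2) (p. 4), §3 (3.1) (p. 8), p. 9 first
  line [LawlerSchrammWernerEJP2002].
* G. F. Lawler, *Conformally invariant processes in the plane*, AMS (2005), Thm. 3.17, Cor. 3.19
  (Koebe one-quarter) [Lawler2008].
* P. Billingsley, *Convergence of Probability Measures*, 2nd ed. (1999), Thm. 2.1 (portmanteau),
  Thm. 5.1 (Prokhorov) [Billingsley1999].

## Mathlib / tree

Mathlib: `Filter.limsup_le_of_le`, `Filter.le_liminf_of_le`, `Filter.eventually_lt_of_limsup_lt`,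
`Filter.eventually_lt_of_lt_liminf`, `le_of_forall_pos_le_add`, `le_of_tendsto`,
`eventually_nhdsWithin_of_forall`, `Real.exp_log`, `Real.log_neg`, `Real.rpow_def_of_pos`, `Real.mul_rpow`.
Tree: `eventually_crossing_le_of_subseqLimits`, `eventually_le_crossing_of_subseqLimits`,
`crossingBounds_of_subseqLimits` (`OneArmSubsequentialLimits.lean`),
`setOf_conformalRadius_le_subset_meetsBall`, `IsHittingPDEData.measure_bounds`,
`IsHittingPDEData.pos`, `IsHittingPDEData.exp_bounds` (`OneArmHittingPDE.lean`),
`tendsto_log_div_log_of_rpow_bounds` (`OneArmScalingLimit.lean`), `koebeCovering_const`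
(`OneArmHittingPDEProofs.lean`), `Literature.Analysis.Complex.conformalRadius_le_four_mul_infDist`
(`ConformalRadius.lean`), `Literature.Analysis.Complex.koebeQuarter_holds`
(`KoebeQuarterProofs.lean`), `LawlerSchrammWerner2002_annulusCrossing_of_crossingBounds_of_coherence`,
`coherence_of_limsup_le_of_le_liminf` (`OneArmAnnulusCrossingCoherence.lean`),
`isHittingPDEData_lswHit`, `lswHit_of_pos`, `continuousOn_lswSeries_init_t`
(`OneArmHittingPDEAnalytic.lean`), `lswHit_two_pi_eq_measureReal_of_forall_pos`
(`OneArmFromTrace.lean`).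
-/

noncomputable section

open MeasureTheory Filter Topology Metric Set TopologicalSpace
open Literature.Probability.LatticeModels Literature.Probability.Percolation
open scoped ENNReal NNReal

namespace Literature.Probability.Percolation

/-! ### The two envelopes of `p(·, R)` meet at `P[𝔯 ≤ 4ρ]` -/

/-- **Upper envelope through Koebe.** If one function `h(2π, ·)` gives the law of the conformal
radius, `h(2π, t) = ν{K | 𝔯(K) ≤ e^{-t}}`, at every weak limit `ν` of the hull laws `lswLaw`
along a sequence `R_k → ∞`, then for `0 < ρ ≤ 1`,
`limsup_R P[C(ρR, R)] ≤ h(2π, -log 4ρ)`: at a subsequential limit,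
`ν{dist(0, K) ≤ ρ} ≤ ν{𝔯(K) ≤ 4ρ}` by Koebe's one-quarter theorem (LSW (2.1), `𝔯/4 ≤ dist(0, Q)`;
`Literature.Analysis.Complex.koebeQuarter_holds`), and the portmanteau bound along extracted
subsequences (`eventually_crossing_le_of_subseqLimits`) transfers this to all large `R`.
[cite: LawlerSchrammWernerEJP2002, (2.1)–(2.2) (p. 4), §3 (3.1) (p. 8)] -/
theorem limsup_crossing_le_hit_of_subseqId {h : ℝ → ℝ → ℝ}
    (hid : ∀ (R : ℕ → ℝ) (ν : ProbabilityMeasure (NonemptyCompacts ℂ)),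
      Tendsto R atTop atTop → Tendsto (lswLaw ∘ R) atTop (𝓝 ν) →
        ∀ t, h (2 * Real.pi) t = (ν : Measure (NonemptyCompacts ℂ)).real
          {K | Literature.Analysis.Complex.conformalRadius (K : Set ℂ) ≤ Real.exp (-t)})
    {ρ : ℝ} (hρ0 : 0 < ρ) (hρ1 : ρ ≤ 1) :
    limsup (fun R : ℝ => (triSitePercolation half).real (triOpenCrossing (ρ * R) R)) atTop ≤
      h (2 * Real.pi) (-Real.log (4 * ρ)) := by
  set t₀ : ℝ := -Real.log (4 * ρ) with ht₀
  have hexp : Real.exp (-t₀) = 4 * ρ := by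
    rw [ht₀, neg_neg]
    exact Real.exp_log (by positivity)
  -- at every subsequential limit: `ν{dist ≤ ρ} ≤ ν{𝔯 ≤ 4ρ} = h(2π, t₀)` (Koebe)
  have hlim : ∀ (R : ℕ → ℝ) (ν : ProbabilityMeasure (NonemptyCompacts ℂ)),
      Tendsto R atTop atTop → Tendsto (lswLaw ∘ R) atTop (𝓝 ν) →
        (ν : Measure (NonemptyCompacts ℂ)).real (meetsClosedBall ρ) ≤ h (2 * Real.pi) t₀ := by
    intro R ν hR hν
    rw [hid R ν hR hν t₀, hexp]
    refine measureReal_mono (fun K hK => ?_) (measure_ne_top _ _)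
    rw [mem_meetsClosedBall_iff] at hK
    rw [mem_setOf_eq]
    have hKoebe := Literature.Analysis.Complex.conformalRadius_le_four_mul_infDist
      (K := (K : Set ℂ)) Literature.Analysis.Complex.koebeQuarter_holds K.nonempty
    linarith
  -- portmanteau along extracted subsequences, for every `ε > 0`
  refine le_of_forall_pos_le_add fun ε hε => ?_
  obtain ⟨s₀, hs₀⟩ := eventually_crossing_le_of_subseqLimits (r := ρ) (u := h (2 * Real.pi) t₀)
    (U := h (2 * Real.pi) t₀ + ε) hρ1 (by linarith) hlim
  exact limsup_le_of_le (isCoboundedUnder_le_of_le atTop fun _ => measureReal_nonneg)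
    ((eventually_ge_atTop s₀).mono fun R hR => hs₀ R hR)

/-- **Lower envelope through Schwarz.** Under the same identification at all subsequential
limits, for `0 < r ≤ 1` and every `t` with `e^{-t} < r`, `h(2π, t) ≤ liminf_R P[C(rR, R)]`: at a
subsequential limit, `ν{𝔯(K) ≤ e^{-t}} ≤ ν{dist(0, K) < r}` by the Schwarz half of LSW (2.1)
(`dist(0, Q) ≤ 𝔯`, `setOf_conformalRadius_le_subset_meetsBall`), transferred to all large `R` by
`eventually_le_crossing_of_subseqLimits`. [cite: LawlerSchrammWernerEJP2002, (2.1)–(2.2) (p. 4), §3 (3.1) (p. 8)] -/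
theorem hit_le_liminf_crossing_of_subseqId {h : ℝ → ℝ → ℝ}
    (hid : ∀ (R : ℕ → ℝ) (ν : ProbabilityMeasure (NonemptyCompacts ℂ)),
      Tendsto R atTop atTop → Tendsto (lswLaw ∘ R) atTop (𝓝 ν) →
        ∀ t, h (2 * Real.pi) t = (ν : Measure (NonemptyCompacts ℂ)).real
          {K | Literature.Analysis.Complex.conformalRadius (K : Set ℂ) ≤ Real.exp (-t)})
    {r : ℝ} (hr1 : r ≤ 1) {t : ℝ} (ht : Real.exp (-t) < r) :
    h (2 * Real.pi) t ≤
      liminf (fun R : ℝ => (triSitePercolation half).real (triOpenCrossing (r * R) R)) atTop := by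
  -- at every subsequential limit: `h(2π, t) = ν{𝔯 ≤ e^{-t}} ≤ ν{dist < r}` (Schwarz)
  have hlim : ∀ (R : ℕ → ℝ) (ν : ProbabilityMeasure (NonemptyCompacts ℂ)),
      Tendsto R atTop atTop → Tendsto (lswLaw ∘ R) atTop (𝓝 ν) →
        h (2 * Real.pi) t ≤ (ν : Measure (NonemptyCompacts ℂ)).real (meetsBall r) := by
    intro R ν hR hν
    rw [hid R ν hR hν t]
    exact measureReal_mono (setOf_conformalRadius_le_subset_meetsBall ht (ht.trans_le hr1))
      (measure_ne_top _ _)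
  refine le_of_forall_pos_le_add fun ε hε => ?_
  obtain ⟨s₀, hs₀⟩ := eventually_le_crossing_of_subseqLimits (r := r) (ℓ := h (2 * Real.pi) t)
    (L := h (2 * Real.pi) t - ε) hr1 (by linarith) hlim
  have hle : h (2 * Real.pi) t - ε ≤
      liminf (fun R : ℝ => (triSitePercolation half).real (triOpenCrossing (r * R) R)) atTop :=
    le_liminf_of_le (isCoboundedUnder_ge_of_le atTop fun _ => measureReal_le_one)
      ((eventually_ge_atTop s₀).mono fun R hR => hs₀ R hR)
  linarith

/-- **Lower envelope at the Koebe radius.** Under the identification at all subsequential limits,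
if `h(2π, ·)` is right-continuous at `t₀ = -log r` (`0 < r ≤ 1`), then
`h(2π, -log r) ≤ liminf_R P[C(rR, R)]`: let `t ↓ t₀` in `hit_le_liminf_crossing_of_subseqId`
(`e^{-t} < e^{-t₀} = r` for `t > t₀`). Left-continuity of `h(2π, ·)` is automatic (continuity of
`ν` from above); right-continuity at `t₀` says that `𝔯 = r` is not an atom.
[cite: LawlerSchrammWernerEJP2002, (2.1)–(2.2) (p. 4), §3 (3.1) (p. 8)] -/
theorem hit_le_liminf_crossing_of_subseqId_of_continuousWithinAt {h : ℝ → ℝ → ℝ}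
    (hid : ∀ (R : ℕ → ℝ) (ν : ProbabilityMeasure (NonemptyCompacts ℂ)),
      Tendsto R atTop atTop → Tendsto (lswLaw ∘ R) atTop (𝓝 ν) →
        ∀ t, h (2 * Real.pi) t = (ν : Measure (NonemptyCompacts ℂ)).real
          {K | Literature.Analysis.Complex.conformalRadius (K : Set ℂ) ≤ Real.exp (-t)})
    {r : ℝ} (hr0 : 0 < r) (hr1 : r ≤ 1)
    (hcont : ContinuousWithinAt (h (2 * Real.pi)) (Ioi (-Real.log r)) (-Real.log r)) :
    h (2 * Real.pi) (-Real.log r) ≤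
      liminf (fun R : ℝ => (triSitePercolation half).real (triOpenCrossing (r * R) R)) atTop := by
  refine le_of_tendsto hcont.tendsto (eventually_nhdsWithin_of_forall fun t ht => ?_)
  refine hit_le_liminf_crossing_of_subseqId hid hr1 ?_
  calc Real.exp (-t) < Real.exp (-(-Real.log r)) := Real.exp_lt_exp.2 (neg_lt_neg (mem_Ioi.1 ht))
    _ = r := by rw [neg_neg, Real.exp_log hr0]

/-! ### Strict scale coherence from the subsequential identification -/

/-- **Strict scale coherence at subsequential limits.** If one function `h(2π, ·)`, positive and
right-continuous at `t₀ = -log 4ρ`, gives `ν{𝔯 ≤ e^{-t}}` at every subsequential weak limit `ν`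
of `lswLaw`, then for `0 < ρ ≤ 1/4`,
`limsup_R P[C(ρR, R)] ≤ h(2π, -log 4ρ) ≤ liminf_R P[C(4ρR, R)]`, whence
`limsup_R P[C(ρR, R)] < 4 liminf_R P[C(4ρR, R)]` — the hypothesis of
`LawlerSchrammWerner2002_annulusCrossing_of_crossingBounds_of_coherence`, obtained WITHOUT any
convergence of `P[C(ρR, R)]` in `R`: the Koebe factor `4` of LSW (2.1) is exactly the ratio of
the radii compared by (3.1). [cite: LawlerSchrammWernerEJP2002, (2.1) (p. 4), §3 (3.1) (p. 8)] -/
theorem coherence_of_subseqId {h : ℝ → ℝ → ℝ}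
    (hid : ∀ (R : ℕ → ℝ) (ν : ProbabilityMeasure (NonemptyCompacts ℂ)),
      Tendsto R atTop atTop → Tendsto (lswLaw ∘ R) atTop (𝓝 ν) →
        ∀ t, h (2 * Real.pi) t = (ν : Measure (NonemptyCompacts ℂ)).real
          {K | Literature.Analysis.Complex.conformalRadius (K : Set ℂ) ≤ Real.exp (-t)})
    {ρ : ℝ} (hρ0 : 0 < ρ) (hρ4 : ρ ≤ 1 / 4)
    (hcont : ContinuousWithinAt (h (2 * Real.pi)) (Ioi (-Real.log (4 * ρ))) (-Real.log (4 * ρ)))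
    (hpos : 0 < h (2 * Real.pi) (-Real.log (4 * ρ))) :
    limsup (fun R : ℝ => (triSitePercolation half).real (triOpenCrossing (ρ * R) R)) atTop <
      4 * liminf (fun R : ℝ => (triSitePercolation half).real (triOpenCrossing (4 * ρ * R) R))
        atTop := by
  have hup := limsup_crossing_le_hit_of_subseqId hid hρ0 (by linarith)
  have hlow := hit_le_liminf_crossing_of_subseqId_of_continuousWithinAt hid (r := 4 * ρ)
    (by positivity) (by linarith) hcont
  linarith

/-! ### The fact from LSW §2 at subsequential limits, with no convergence input -/

/-- **LSW Thm. 1.2 + (3.1) from the subsequential hitting-PDE hypotheses and continuity of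
`h(2π, ·)`.** Let `(h, h_θ, h_θθ, h_t)` have the properties of LSW Lemma 2.2, (2.3), Lemma 2.3
(`H : IsHittingPDEData …`), let `h(2π, t) = ν{K | 𝔯(K) ≤ e^{-t}}` for every weak limit `ν` of
`lswLaw` along a sequence `R_k → ∞` and all `t` (`hid`), and let `h(2π, ·)` be continuous on
`(0, ∞)` (no atoms of `𝔯`). Then `LawlerSchrammWerner2002_annulusCrossing` holds: the uniform
power bounds come from `IsHittingPDEData.measure_bounds` and `crossingBounds_of_subseqLimits` (as in
`oneArm_exponent_of_subseqHittingPDE`), strict coherence for `ρ ∈ (0, 1/8)` from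
`coherence_of_subseqId` (`-log 4ρ > log 2 > 0`, `h(2π, ·) > 0` by `IsHittingPDEData.pos`), and
`LawlerSchrammWerner2002_annulusCrossing_of_crossingBounds_of_coherence` concludes. Compare
`LawlerSchrammWerner2002_annulusCrossing_of_subseqHittingPDE` (`OneArmAnnulusCrossingProofs.lean`),
which assumes radial convergence off a countable set instead of continuity.
[cite: LawlerSchrammWernerEJP2002, Thm. 1.2 (p. 2), (2.1)–(2.2) (p. 4), §3 (3.1) (p. 8)] -/
theorem LawlerSchrammWerner2002_annulusCrossing_of_subseqHittingPDE_of_continuousOn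
    {h hθ hθθ ht : ℝ → ℝ → ℝ} (H : IsHittingPDEData h hθ hθθ ht)
    (hid : ∀ (R : ℕ → ℝ) (ν : ProbabilityMeasure (NonemptyCompacts ℂ)),
      Tendsto R atTop atTop → Tendsto (lswLaw ∘ R) atTop (𝓝 ν) →
        ∀ t, h (2 * Real.pi) t = (ν : Measure (NonemptyCompacts ℂ)).real
          {K | Literature.Analysis.Complex.conformalRadius (K : Set ℂ) ≤ Real.exp (-t)})
    (hcont : ContinuousOn (h (2 * Real.pi)) (Ioi 0)) :
    LawlerSchrammWerner2002_annulusCrossing := by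
  obtain ⟨C, hC, hb⟩ := H.measure_bounds koebeCovering_const (by positivity)
  have hlim : ∀ (R : ℕ → ℝ) (ν : ProbabilityMeasure (NonemptyCompacts ℂ)),
      Tendsto R atTop atTop → Tendsto (lswLaw ∘ R) atTop (𝓝 ν) →
        ∀ r : ℝ, 0 < r → r < 1 / 2 →
          C⁻¹ * r ^ (5 / 48 : ℝ) ≤ (ν : Measure (NonemptyCompacts ℂ)).real (meetsBall r) ∧
            (ν : Measure (NonemptyCompacts ℂ)).real (meetsClosedBall r) ≤ C * r ^ (5 / 48 : ℝ) :=
    fun R ν hR hν => hb ν (hid R ν hR hν)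
  refine LawlerSchrammWerner2002_annulusCrossing_of_crossingBounds_of_coherence hC
    (fun r hr0 hr2 => crossingBounds_of_subseqLimits hC hlim hr0 hr2) fun ρ hρ0 hρ8 => ?_
  -- `t₀ = -log 4ρ > 0` since `4ρ < 1/2 < 1`
  have ht₀ : 0 < -Real.log (4 * ρ) := by
    rw [neg_pos]
    exact Real.log_neg (by positivity) (by linarith)
  exact coherence_of_subseqId hid hρ0 (by linarith)
    ((hcont _ ht₀).mono (Ioi_subset_Ioi ht₀.le))
    (H.pos (2 * Real.pi) ⟨by positivity, le_rfl⟩ _)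

/-- `t ↦ u(2π, t)` (`u = lswHit 6`) is continuous on `(0, ∞)`: there it is the series solution
(`lswHit_of_pos`), continuous in `t` at every `θ ∈ (0, 2π]` (`continuousOn_lswSeries_init_t`).
[cite: LawlerSchrammWernerEJP2002, Lemma 2.2 (p. 4)] -/
theorem continuousOn_lswHit_two_pi : ContinuousOn (lswHit 6 (2 * Real.pi)) (Ioi 0) :=
  (continuousOn_lswSeries_init_t (θ := 2 * Real.pi) ⟨by positivity, le_rfl⟩).congr
    fun _ ht => lswHit_of_pos ht ⟨by positivity, le_rfl⟩

/-- **LSW Theorem 1.2 with (3.1) from the subsequential trace identification alone.** If for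
every weak limit `ν` of the hull laws `lswLaw` along a sequence `R_k → ∞` and every `t > 0`,
`u(2π, t) = ν{K | 𝔯(K) ≤ e^{-t}}` (`u = lswHit 6`, the PROVED semigroup solution of LSW's PDE
(2.4) with (2.3) and (2.12), `isHittingPDEData_lswHit`) — LSW (2.2) at `θ = 2π` read through
Smirnov's Theorem 2.1, the radial Loewner equation (2.5)–(2.9) and the strong Markov property
(2.10) — then `LawlerSchrammWerner2002_annulusCrossing` holds: there is one `u` with
`log u(r)/log r → 5/48` and `u(r/2)/2 ≤ P[C(rR, R)] ≤ 2 u(2r)` for `r ∈ (0, 1/2)`, `R ≥ s₀(r)`.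
By `LawlerSchrammWerner2002_annulusCrossing_of_subseqHittingPDE_of_continuousOn`, the
identification at `t ≤ 0` being automatic (`lswHit_two_pi_eq_measureReal_of_forall_pos`) and
`u(2π, ·)` continuous on `(0, ∞)` (`continuousOn_lswHit_two_pi`). Neither the existence of the
full scaling limit (`∃ ν, Tendsto lswLaw atTop (𝓝 ν)`) nor any radial convergence is used;
this is the exact analogue of `oneArm_exponent_of_subseqTrace`,
`LawlerSchrammWerner2002_hittingPDE_of_subseqTrace` and
`LawlerSchrammWerner2002_scalingLimitExponent_of_subseqTrace`.
[cite: LawlerSchrammWernerEJP2002, Thm. 1.2 (p. 2), §2 (pp. 3–8), §3 (3.1) (p. 8)] -/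
theorem LawlerSchrammWerner2002_annulusCrossing_of_subseqTrace
    (htr : ∀ (R : ℕ → ℝ) (ν : ProbabilityMeasure (NonemptyCompacts ℂ)),
      Tendsto R atTop atTop → Tendsto (lswLaw ∘ R) atTop (𝓝 ν) →
        ∀ t : ℝ, 0 < t → lswHit 6 (2 * Real.pi) t = (ν : Measure (NonemptyCompacts ℂ)).real
          {K | Literature.Analysis.Complex.conformalRadius (K : Set ℂ) ≤ Real.exp (-t)}) :
    LawlerSchrammWerner2002_annulusCrossing :=
  LawlerSchrammWerner2002_annulusCrossing_of_subseqHittingPDE_of_continuousOn isHittingPDEData_lswHit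
    (fun R ν hR hν => lswHit_two_pi_eq_measureReal_of_forall_pos ν (htr R ν hR hν))
    continuousOn_lswHit_two_pi

/-- **All four at once.** The subsequential trace identification alone yields LSW's (3.1) with
Thm. 1.2 (`LawlerSchrammWerner2002_annulusCrossing`), the hitting-PDE fact
(`LawlerSchrammWerner2002_hittingPDE`), LSW Thm. 1.2 at every weak limit
(`LawlerSchrammWerner2002_scalingLimitExponent`) and the one-arm exponent `5/48`
(`oneArm_exponent`, LSW Thm. 1.1). [cite: LawlerSchrammWernerEJP2002, Thms. 1.1–1.2 (p. 2), §2–§3] -/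
theorem LawlerSchrammWerner2002_continuumFacts_of_subseqTrace
    (htr : ∀ (R : ℕ → ℝ) (ν : ProbabilityMeasure (NonemptyCompacts ℂ)),
      Tendsto R atTop atTop → Tendsto (lswLaw ∘ R) atTop (𝓝 ν) →
        ∀ t : ℝ, 0 < t → lswHit 6 (2 * Real.pi) t = (ν : Measure (NonemptyCompacts ℂ)).real
          {K | Literature.Analysis.Complex.conformalRadius (K : Set ℂ) ≤ Real.exp (-t)}) :
    LawlerSchrammWerner2002_annulusCrossing ∧ LawlerSchrammWerner2002_hittingPDE ∧
      LawlerSchrammWerner2002_scalingLimitExponent ∧ oneArm_exponent :=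
  ⟨LawlerSchrammWerner2002_annulusCrossing_of_subseqTrace htr,
    LawlerSchrammWerner2002_hittingPDE_of_subseqTrace htr,
    LawlerSchrammWerner2002_scalingLimitExponent_of_subseqTrace htr, oneArm_exponent_of_subseqTrace htr⟩

/-! ### LSW's `u` made explicit: (3.1) with `u(r) = P[𝔯 ≤ 2r]` -/

/-- **"By Theorem 1.2, `log u(r)/log r → 5/48`" for `u(r) = h(2π, -log 2r) = P[𝔯 ≤ 2r]`** (LSW
p. 9, first line): the two-sided exponential bounds `c e^{-5t/48} ≤ h(2π, t) ≤ c' e^{-5t/48}` of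
the maximum-principle comparison (2.17) (`IsHittingPDEData.exp_bounds`, `t ≥ 2`) read
`c 2^{5/48} r^{5/48} ≤ u(r) ≤ c' 2^{5/48} r^{5/48}` for `2r ≤ e^{-2}`, whence the logarithmic
exponent (`tendsto_log_div_log_of_rpow_bounds`). [cite: LawlerSchrammWernerEJP2002, Thm. 1.2 (p. 2), (2.17) (p. 7), p. 9] -/
theorem tendsto_log_hit_div_log {h hθ hθθ ht : ℝ → ℝ → ℝ} (H : IsHittingPDEData h hθ hθθ ht) :
    Tendsto (fun r => Real.log (h (2 * Real.pi) (-Real.log (2 * r))) / Real.log r) (𝓝[>] 0)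
      (𝓝 (5 / 48)) := by
  obtain ⟨c, c', hc, hc', hlow, hup⟩ := H.exp_bounds
  have h2a : 0 < (2 : ℝ) ^ (5 / 48 : ℝ) := Real.rpow_pos_of_pos two_pos _
  refine tendsto_log_div_log_of_rpow_bounds (L := c * (2 : ℝ) ^ (5 / 48 : ℝ))
    (U := c' * (2 : ℝ) ^ (5 / 48 : ℝ)) (δ := Real.exp (-2) / 2) (mul_pos hc h2a) (mul_pos hc' h2a)
    (by positivity) fun r hr0 hrδ => ?_
  have h2r : 0 < 2 * r := by positivity
  -- `t = -log 2r ≥ 2`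
  have ht2 : 2 ≤ -Real.log (2 * r) := by
    have h1 : Real.log (2 * r) < Real.log (Real.exp (-2)) :=
      Real.log_lt_log h2r (by linarith)
    rw [Real.log_exp] at h1
    linarith
  -- `e^{-5t/48} = (2r)^{5/48} = 2^{5/48} r^{5/48}`
  have key : Real.exp (-(5 / 48 * -Real.log (2 * r))) = (2 : ℝ) ^ (5 / 48 : ℝ) * r ^ (5 / 48 : ℝ) := by
    rw [← Real.mul_rpow zero_le_two hr0.le, Real.rpow_def_of_pos h2r]
    congr 1
    ring
  refine ⟨?_, ?_⟩
  · have := hlow (-Real.log (2 * r)) (by linarith)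
    rw [key] at this
    linarith [this]
  · have := hup _ ht2
    rw [key] at this
    linarith [this]

/-- **LSW's (3.1) with `u` explicit.** Under the subsequential identification `hid` of one
function `h(2π, ·)`, positive (`IsHittingPDEData.pos`) and continuous on `(0, ∞)`, with the laws
of `𝔯` at all subsequential limits, the printed sandwich (3.1) holds with
`u(r) := h(2π, -log 2r) = P[𝔯 ≤ 2r]`: for every `r ∈ (0, 1/2)` and all large `R`,
`u(r/2)/2 = h(2π, -log r)/2 ≤ P[C(rR, R)] ≤ 2 h(2π, -log 4r) = 2 u(2r)` — the lower envelope at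
`r` (`hit_le_liminf_crossing_of_subseqId_of_continuousWithinAt`) and the upper envelope at `r`
(`limsup_crossing_le_hit_of_subseqId`), each with the factor-`2` slack of (3.1) making the
eventual inequalities strict. [cite: LawlerSchrammWernerEJP2002, §3 (3.1) (p. 8), (2.1)–(2.2) (p. 4)] -/
theorem crossing_mem_Icc_hit_of_subseqId {h hθ hθθ ht : ℝ → ℝ → ℝ} (H : IsHittingPDEData h hθ hθθ ht)
    (hid : ∀ (R : ℕ → ℝ) (ν : ProbabilityMeasure (NonemptyCompacts ℂ)),
      Tendsto R atTop atTop → Tendsto (lswLaw ∘ R) atTop (𝓝 ν) →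
        ∀ t, h (2 * Real.pi) t = (ν : Measure (NonemptyCompacts ℂ)).real
          {K | Literature.Analysis.Complex.conformalRadius (K : Set ℂ) ≤ Real.exp (-t)})
    (hcont : ContinuousOn (h (2 * Real.pi)) (Ioi 0)) {r : ℝ} (hr0 : 0 < r) (hr2 : r < 1 / 2) :
    ∃ s₀ : ℝ, ∀ R : ℝ, s₀ ≤ R →
      h (2 * Real.pi) (-Real.log r) / 2 ≤ (triSitePercolation half).real (triOpenCrossing (r * R) R) ∧
        (triSitePercolation half).real (triOpenCrossing (r * R) R) ≤
          2 * h (2 * Real.pi) (-Real.log (4 * r)) := by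
  have h2π : 2 * Real.pi ∈ Ioc 0 (2 * Real.pi) := ⟨by positivity, le_rfl⟩
  -- lower: `h(2π, -log r) ≤ liminf`, and `h(2π, -log r)/2 < h(2π, -log r)`
  have ht₀ : 0 < -Real.log r := by
    rw [neg_pos]
    exact Real.log_neg hr0 (by linarith)
  have hq : 0 < h (2 * Real.pi) (-Real.log r) := H.pos _ h2π _
  have hlim := hit_le_liminf_crossing_of_subseqId_of_continuousWithinAt hid hr0 (by linarith)
    ((hcont _ ht₀).mono (Ioi_subset_Ioi ht₀.le))
  have hlow : ∀ᶠ R : ℝ in atTop,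
      h (2 * Real.pi) (-Real.log r) / 2 < (triSitePercolation half).real (triOpenCrossing (r * R) R) :=
    eventually_lt_of_lt_liminf (by linarith) (isBoundedUnder_of ⟨0, fun _ => measureReal_nonneg⟩)
  -- upper: `limsup ≤ h(2π, -log 4r) < 2 h(2π, -log 4r)`
  have hQ : 0 < h (2 * Real.pi) (-Real.log (4 * r)) := H.pos _ h2π _
  have hlims := limsup_crossing_le_hit_of_subseqId hid hr0 (by linarith)
  have hup : ∀ᶠ R : ℝ in atTop,
      (triSitePercolation half).real (triOpenCrossing (r * R) R) < 2 * h (2 * Real.pi) (-Real.log (4 * r)) :=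
    eventually_lt_of_limsup_lt (by linarith) (isBoundedUnder_of ⟨1, fun _ => measureReal_le_one⟩)
  obtain ⟨s₀, hs₀⟩ := eventually_atTop.1 (hlow.and hup)
  exact ⟨s₀, fun R hR => ⟨(hs₀ R hR).1.le, (hs₀ R hR).2.le⟩⟩

/-- **Theorem 1.2 with (3.1), witnessed by the law of the conformal radius.** Under `H`, `hid` and
continuity of `h(2π, ·)` on `(0, ∞)`, `LawlerSchrammWerner2002_annulusCrossing` holds with the
EXPLICIT witness `u(r) = h(2π, -log 2r)` (`= P[𝔯 ≤ 2r]` at every subsequential limit): a second,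
direct proof of `LawlerSchrammWerner2002_annulusCrossing_of_subseqHittingPDE_of_continuousOn`
(whose `u`, from `LawlerSchrammWerner2002_annulusCrossing_of_crossingBounds_of_coherence`, is the
geometric mean of the discrete envelopes), by `tendsto_log_hit_div_log` and
`crossing_mem_Icc_hit_of_subseqId`. [cite: LawlerSchrammWernerEJP2002, Thm. 1.2 (p. 2), §3 (3.1) (p. 8), p. 9] -/
theorem LawlerSchrammWerner2002_annulusCrossing_of_subseqHittingPDE_of_continuousOn'
    {h hθ hθθ ht : ℝ → ℝ → ℝ} (H : IsHittingPDEData h hθ hθθ ht)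
    (hid : ∀ (R : ℕ → ℝ) (ν : ProbabilityMeasure (NonemptyCompacts ℂ)),
      Tendsto R atTop atTop → Tendsto (lswLaw ∘ R) atTop (𝓝 ν) →
        ∀ t, h (2 * Real.pi) t = (ν : Measure (NonemptyCompacts ℂ)).real
          {K | Literature.Analysis.Complex.conformalRadius (K : Set ℂ) ≤ Real.exp (-t)})
    (hcont : ContinuousOn (h (2 * Real.pi)) (Ioi 0)) :
    LawlerSchrammWerner2002_annulusCrossing := by
  refine ⟨fun s => h (2 * Real.pi) (-Real.log (2 * s)), tendsto_log_hit_div_log H,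
    fun r hr0 hr2 => ?_⟩
  obtain ⟨s₀, hs₀⟩ := crossing_mem_Icc_hit_of_subseqId H hid hcont hr0 hr2
  refine ⟨s₀, fun R hR => ?_⟩
  simp only [show (2 : ℝ) * (r / 2) = r by ring, show (2 : ℝ) * (2 * r) = 4 * r by ring]
  exact hs₀ R hR

/-- **LSW's (3.1) for the trace, explicitly**: under the subsequential trace identification, for
every `r ∈ (0, 1/2)` and all large `R`,
`u(2π, -log r)/2 ≤ P[C(rR, R)] ≤ 2 u(2π, -log 4r)` with `u = lswHit 6` the explicit series
solution of LSW's PDE — the discrete annulus-crossing probabilities of critical site percolation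
are eventually sandwiched by the computable continuum function `ρ ↦ u(2π, -log ρ)` (the
`SLE₆` law `P[𝔯 ≤ ρ]`) at the radii `r` and `4r`.
[cite: LawlerSchrammWernerEJP2002, §3 (3.1) (p. 8), Lemma 2.2 (p. 4)] -/
theorem crossing_mem_Icc_lswHit_of_subseqTrace
    (htr : ∀ (R : ℕ → ℝ) (ν : ProbabilityMeasure (NonemptyCompacts ℂ)),
      Tendsto R atTop atTop → Tendsto (lswLaw ∘ R) atTop (𝓝 ν) →
        ∀ t : ℝ, 0 < t → lswHit 6 (2 * Real.pi) t = (ν : Measure (NonemptyCompacts ℂ)).real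
          {K | Literature.Analysis.Complex.conformalRadius (K : Set ℂ) ≤ Real.exp (-t)})
    {r : ℝ} (hr0 : 0 < r) (hr2 : r < 1 / 2) :
    ∃ s₀ : ℝ, ∀ R : ℝ, s₀ ≤ R →
      lswHit 6 (2 * Real.pi) (-Real.log r) / 2 ≤
          (triSitePercolation half).real (triOpenCrossing (r * R) R) ∧
        (triSitePercolation half).real (triOpenCrossing (r * R) R) ≤
          2 * lswHit 6 (2 * Real.pi) (-Real.log (4 * r)) :=
  crossing_mem_Icc_hit_of_subseqId isHittingPDEData_lswHit
    (fun R ν hR hν => lswHit_two_pi_eq_measureReal_of_forall_pos ν (htr R ν hR hν))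
    continuousOn_lswHit_two_pi hr0 hr2

/-- **The logarithmic exponent of the explicit `u`**: `log u(2π, -log 2r) / log r → 5/48` as
`r ↓ 0` (`u = lswHit 6`). [cite: LawlerSchrammWernerEJP2002, Thm. 1.2 (p. 2), p. 9] -/
theorem tendsto_log_lswHit_div_log :
    Tendsto (fun r => Real.log (lswHit 6 (2 * Real.pi) (-Real.log (2 * r))) / Real.log r) (𝓝[>] 0)
      (𝓝 (5 / 48)) :=
  tendsto_log_hit_div_log isHittingPDEData_lswHit

end Literature.Probability.Percolation
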